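import Summits.NavierStokesRegularity.NavierStokesRegularity.Theorems.ScenarioCensusRowF1IntQuenchEnstrophy
import Summits.NavierStokesRegularity.NavierStokesRegularity.Theorems.ScenarioCensusRowF1IntStretchBudget
import HarnessLib

/-!
# LINE «integrated-quench» port, part 5/7: §4 (d) — the far past `Φ = O((−σ)^{-1/2})`, the transport Liouville theorem; §5 fast points and the upgrade of a closed
# scale-invariant sign condition (transfer lemmas BY NAME)

Re-homed for the scenario census (typer seat ns-census-typer-1 g8; the cell F1iq and the floor DI are MEMBERS OF RECORD «DECIDED IN KERNEL IN FILES» of row F1 since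
census v1.76 (critic idea-crit-3 g7 PASS — no price 01:59:11Z; ref ns-census-ref g9 PRE-CHECK ✓ §14.27 item 35; lead-presearch label); this port makes them TREE-decided):
VERBATIM PORT of ns-idea-3 LINE 22 «integrated-quench», `pub/ideators/ns-idea-3/lines/integrated-quench/line-integrated-quench.lean` sha16 d7402efa28ebc137 (2066 l.,
lean check rc 0, 0 sorry), split for the 400-line rule into seven parts `ScenarioCensusRowF1IntQuench{∅, Kill, Cutoff, Enstrophy, Liouville, Transfer, Top}` (chain
imports).  Lean text VERBATIM in namespace `…Theorems.ScenarioCensus.IntegratedQuench` (the line's `…Cruxes.ScenarioCensusRowF1.IntegratedQuenchLine` re-homed); port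
edits: the bracket lines `section IntegralTransfer` / `end IntegralTransfer` dropped (no `variable`s), `@[conjecture]` on the residual `IqSlack` (≡ `ScenarioCensus.Row_F1`,
OPEN), forty-five one-line docstrings added (gate lint); lemmas the line shares VERBATIM with the landed inviscid-top / frozen-top / columnar-top / stretched-top /
integrated-stretch ports are taken BY NAME (listed below); `norm_laplacian_curl_le` (twin of the tree's `clockAP_norm_laplacian_curl_le`, whose module has no farm build) is
not re-declared and its single use carries the line's own proof as a local `have` (proof text only).  Statements untouched.

No census VALUE is moved here (row F1 stays OPEN-WITH-LINE; the members become TREE-decided by name); NS regularity is NOT proved; `Row_F1` is untouched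
(zero movement, `iqSlack_iff_rowF1`); no summit statement is proved by this file. Lemmas that restate already-landed tree declarations are taken BY NAME (gate lint `dedup.landed`): `convect_curl_self` = `FrozenTop.convect_curl_self`, `fderiv_smul_stPull_apply` = `InviscidTop.fderiv_smul_stPull_apply`, `fderiv_smul_stPull` = `InviscidTop.fderiv_smul_stPull`, `fderiv_fderiv_smul_stPull` = `InviscidTop.fderiv_fderiv_smul_stPull`, `tendsto_clm_of_tendsto_apply` = `InviscidTop.tendsto_clm_of_tendsto_apply`, `tendsto_fderiv_fderiv_apply_of_bound` = `InviscidTop.tendsto_fderiv_fderiv_apply_of_bound`, `tendsto_fderiv_fderiv_of_bound` = `InviscidTop.tendsto_fderiv_fderiv_of_bound`, `tendsto_fderiv_fderiv_of_typeI_seq_Ioo` = `InviscidTop.tendsto_fderiv_fderiv_of_typeI_seq_Ioo`, `fderiv3_smul_stPull` = `FrozenTop.fderiv3_smul_stPull`, `tendsto_fderiv3_of_typeI_seq_Ioo` = `FrozenTop.tendsto_fderiv3_of_typeI_seq_Ioo`, `tendsto_physicalTime` = `ColumnarTop.tendsto_physicalTime`, `eventually_fast` = `ColumnarTop.eventually_fast`,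 `sqrt_timeLag` = `StretchedTop.sqrt_timeLag`, `forall_of_forall_ne_zero` = `StretchedTop.forall_of_forall_ne_zero`, `radius_eq` = `FrozenTop.radius_eq`, `jointCond_everywhere₆` = `FrozenTop.jointCond_everywhere₄`, `continuousOn_quad` = `IntegratedStretch.continuousOn_quad`, `sqrt_nu_timeLag` = `IntegratedStretch.sqrt_nu_timeLag`, `continuous_maxRdnu` = `IntegratedStretch.continuous_maxRdnu`, `sing_of_not_bounded` = `InviscidTop.sing_of_not_bounded`, `nonIntensifying_ancient_trivial` = `eq_zero_of_nonIntensifying`, `vort_eq` = `FrozenTop.freeze_eq`, `exists_singularZoom_package₃` = `FrozenTop.exists_singularZoom_package₃`, `lapD_eq_zero_of_eq_zero` = `FrozenTop.lapD_eq_zero_of_eq_zero`.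
-/

-- the summit and its single problem share the name `NavierStokesRegularity` (D-0017 nested layout)
set_option linter.dupNamespace false

noncomputable section

open MeasureTheory Set Function Filter TopologicalSpace Metric
open scoped Topology NNReal ENNReal InnerProductSpace RealInnerProductSpace Laplacian

namespace Summit.NavierStokesRegularity.NavierStokesRegularity.Theorems.ScenarioCensus.IntegratedQuench

open Literature.Analysis Literature.Analysis.FluidPDE
open Summit.NavierStokesRegularity.NavierStokesRegularity.Theorems

/-! ## The far past: `Φ(σ) = O((−σ)^{-1/2})` by the scaling-sharp gradient decay -/

/-- `Φ(σ)` is bounded through a gradient bound on the window. -/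
theorem Phi_le_of_fderiv_le {C : ℝ} {W : ℝ → E3 → E3} (hW : IsTypeIAncientMild C W) (y₀ : E3) {K : ℝ}
    (hK : ∀ s < (0 : ℝ), ∀ y : E3, ‖fderiv ℝ (W s) y‖ ≤ K / (-s)) {σ : ℝ} (hσ : σ < 0) :
    Phi C W y₀ σ ≤ volume.real (closedBall y₀ (Real.sqrt 2 * Rad C σ)) * (‖curlCLM‖ * K / (-σ)) ^ 2 := by
  have hC := hW.nonneg
  have hpt : ∀ y, ‖curl (W σ) y‖ ^ 2 * chi C y₀ σ y ≤
      (closedBall y₀ (Real.sqrt 2 * Rad C σ)).indicator (fun _ => (‖curlCLM‖ * K / (-σ)) ^ 2) y := by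
    intro y
    by_cases hy : y ∈ closedBall y₀ (Real.sqrt 2 * Rad C σ)
    · rw [indicator_of_mem hy]
      have hω : ‖curl (W σ) y‖ ≤ ‖curlCLM‖ * K / (-σ) := by
        refine (norm_curl_le _ _).trans ?_
        rw [mul_div_assoc]
        exact mul_le_mul_of_nonneg_left (hK σ hσ y) (ContinuousLinearMap.opNorm_nonneg _)
      calc ‖curl (W σ) y‖ ^ 2 * chi C y₀ σ y ≤ ‖curl (W σ) y‖ ^ 2 * 1 :=
            mul_le_mul_of_nonneg_left (chi_le_one C y₀ σ y) (sq_nonneg _)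
        _ ≤ (‖curlCLM‖ * K / (-σ)) ^ 2 := by
            rw [mul_one]; exact pow_le_pow_left₀ (norm_nonneg _) hω 2
    · rw [indicator_of_notMem hy, chi_eq_zero hC (by rwa [mem_closedBall_iff_norm, not_le] at hy), mul_zero]
  have hind : Integrable ((closedBall y₀ (Real.sqrt 2 * Rad C σ)).indicator
      fun _ => (‖curlCLM‖ * K / (-σ)) ^ 2) volume :=
    (integrableOn_const (measure_closedBall_lt_top (x := y₀) (r := Real.sqrt 2 * Rad C σ)).ne).integrable_indicator
      measurableSet_closedBall
  calc Phi C W y₀ σ ≤ ∫ y, (closedBall y₀ (Real.sqrt 2 * Rad C σ)).indicator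
        (fun _ => (‖curlCLM‖ * K / (-σ)) ^ 2) y := integral_mono (integrable_integrand hW y₀ hσ) hind hpt
    _ = _ := by rw [integral_indicator_const _ measurableSet_closedBall, smul_eq_mul]

/-- **Smallness in the far past**: for every `δ > 0` and `s < 0` there is `σ ≤ s` with `Φ(σ) ≤ δ`. -/
theorem exists_Phi_le {C : ℝ} {W : ℝ → E3 → E3} (hW : IsTypeIAncientMild C W) (y₀ : E3) {δ : ℝ} (hδ : 0 < δ)
    {s : ℝ} (hs : s < 0) : ∃ σ ≤ s, Phi C W y₀ σ ≤ δ := by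
  have hC := hW.nonneg
  obtain ⟨K, hK⟩ := exists_norm_fderiv_le_div C
  -- the constant `A` with `Φ(−u²) ≤ A / u` for `u ≥ 1`
  obtain ⟨v₁, hv₁⟩ : ∃ v₁ : ℝ, v₁ = volume.real (ball (0 : E3) 1) := ⟨_, rfl⟩
  have hv₁0 : 0 ≤ v₁ := by rw [hv₁]; exact measureReal_nonneg
  obtain ⟨A, hA⟩ : ∃ A : ℝ, A = (Real.sqrt 2 * (1 + 2 * C)) ^ 3 * v₁ * (‖curlCLM‖ * K) ^ 2 := ⟨_, rfl⟩
  have hA0 : 0 ≤ A := by rw [hA]; positivity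
  obtain ⟨u, hu⟩ : ∃ u : ℝ, u = max 1 (max (A / δ + 1) (Real.sqrt (-s))) := ⟨_, rfl⟩
  have hu1 : 1 ≤ u := by rw [hu]; exact le_max_left _ _
  have hu0 : 0 < u := by linarith
  have huA : A / δ + 1 ≤ u := by rw [hu]; exact le_trans (le_max_left _ _) (le_max_right _ _)
  have hus : Real.sqrt (-s) ≤ u := by rw [hu]; exact le_trans (le_max_right _ _) (le_max_right _ _)
  refine ⟨-u ^ 2, ?_, ?_⟩
  · have h1 : Real.sqrt (-s) ^ 2 = -s := Real.sq_sqrt (by linarith)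
    nlinarith [Real.sqrt_nonneg (-s)]
  have hσ : -u ^ 2 < 0 := by nlinarith
  refine (Phi_le_of_fderiv_le hW y₀ (hK hW) hσ).trans ?_
  have hsq : Real.sqrt (-(-u ^ 2)) = u := by rw [neg_neg, Real.sqrt_sq hu0.le]
  have hRad : Rad C (-u ^ 2) = 1 + 2 * C * u := by rw [Rad, hsq]
  have hRle : Rad C (-u ^ 2) ≤ (1 + 2 * C) * u := by rw [hRad]; nlinarith
  have hR0 : 0 ≤ Real.sqrt 2 * Rad C (-u ^ 2) := by have := Rad_pos hC (-u ^ 2); positivity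
  rw [Measure.addHaar_real_closedBall _ _ hR0, finrank_euclideanSpace_fin, ← hv₁, neg_neg]
  calc (Real.sqrt 2 * Rad C (-u ^ 2)) ^ 3 * v₁ * (‖curlCLM‖ * K / u ^ 2) ^ 2
      ≤ (Real.sqrt 2 * ((1 + 2 * C) * u)) ^ 3 * v₁ * (‖curlCLM‖ * K / u ^ 2) ^ 2 := by gcongr
    _ = A / u := by rw [hA]; field_simp
    _ ≤ A / (A / δ + 1) := div_le_div_of_nonneg_left hA0 (by positivity) huA
    _ ≤ δ := by
        rw [div_le_iff₀ (by positivity)]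
        have : δ * (A / δ + 1) = A + δ := by field_simp
        nlinarith

/-! ## The transport Liouville theorem -/

/-- **Materially non-intensifying `𝒦` is trivial.** If `W ∈ 𝒦_C` satisfies `⟪ω, Δω + (ω·∇)W⟫ ≤ 0` everywhere
(the vorticity modulus is non-increasing along particle paths, by the vorticity equation), then `W ≡ 0`.
NEW MECHANISM (transport / domain-of-dependence energy argument): the cut-off enstrophy
`Φ(σ) = ∫ |ω|² ψ(‖y − y₀‖²/Rad(σ)²)` with `Rad(σ) = 1 + 2C√(−σ)` shrinking forward at the Type-I speed is
non-increasing (vorticity equation + `div W = 0` + `‖W‖ ≤ C/√(−σ)`), and tends to `0` in the far past by the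
scaling-sharp gradient decay `‖∇W(σ)‖ ≤ K/(−σ)` (volume `∼ (−σ)^{3/2}`, density `∼ (−σ)^{−2}`); hence `Φ ≡ 0`,
`ω ≡ 0`, and the tree's harmonic-vorticity Liouville theorem (B) `eq_zero_of_curl_harmonic_slice` gives `W ≡ 0`. -/
theorem eq_zero_of_nonIntensifying {C : ℝ} {W : ℝ → E3 → E3} (hW : IsTypeIAncientMild C W)
    (h : ∀ s < (0 : ℝ), ∀ y : E3, ⟪curl (W s) y, (Δ (curl (W s))) y + convect (curl (W s)) (W s) y⟫ ≤ 0) :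
    ∀ s < (0 : ℝ), ∀ y : E3, W s y = 0 := by
  have hC := hW.nonneg
  have hω : ∀ s < (0 : ℝ), ∀ y₀ : E3, curl (W s) y₀ = 0 := by
    intro s hs y₀
    have hanti := antitoneOn_Phi hW h y₀
    have hΦ0 : Phi C W y₀ s = 0 := by
      refine le_antisymm ?_ (Phi_nonneg C W y₀ s)
      by_contra hpos
      rw [not_le] at hpos
      obtain ⟨σ, hσs, hσδ⟩ := exists_Phi_le hW y₀ (half_pos hpos) hs
      have hσ0 : σ < 0 := lt_of_le_of_lt hσs hs
      have hmono : Phi C W y₀ s ≤ Phi C W y₀ σ := hanti hσ0 hs hσs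
      linarith
    have hae := (integral_eq_zero_iff_of_nonneg (fun y => mul_nonneg (sq_nonneg _) (chi_nonneg C y₀ s y))
      (integrable_integrand hW y₀ hs)).1 hΦ0
    have hfun := (Continuous.ae_eq_iff_eq volume (continuous_integrand hW y₀ hs) continuous_const).1 hae
    have h0 : ‖curl (W s) y₀‖ ^ 2 * chi C y₀ s y₀ = 0 := congrFun hfun y₀
    rw [chi_self, mul_one] at h0
    exact norm_eq_zero.1 ((pow_eq_zero_iff two_ne_zero).1 h0)
  have hz : curl (W (-1)) = 0 := funext fun y => hω (-1) (by norm_num) y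
  have hΔ : ∀ y, (Δ (curl (W (-1)))) y = 0 := by
    intro y
    rw [hz]
    exact laplacian_eq_zero_of_notMem_tsupport (by rw [tsupport_eq_empty_iff.2 rfl]; exact notMem_empty y)
  exact PoloidalWindowDoorPoloidalWindowRigidityVorticityTranslate.eq_zero_of_curl_harmonic_slice hW.hasTypeITimeDecay hW.continuousOn_uncurry
    (fun s t hst ht x => hW.mild_eq_heatExtension hst ht x) (fun t ht => hW.isDivFree ht)
    (by norm_num : (-1 : ℝ) < 0) hΔ

/-! ## §5 Fast points of the zoom, and the upgrade of a closed scale-invariant sign condition from `{W ≠ 0}` to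
everywhere in `𝒦` (LINE 21 §6, the parts the integral transfer uses; re-proved verbatim) -/

-- `tendsto_physicalTime`: the line restates the tree's `ColumnarTop.tendsto_physicalTime`; taken BY NAME (gate lint dedup.landed).

-- `sqrt_timeLag`: the line restates the tree's `StretchedTop.sqrt_timeLag`; taken BY NAME (gate lint dedup.landed).

-- `eventually_fast`: the line restates the tree's `ColumnarTop.eventually_fast`; taken BY NAME (gate lint dedup.landed).

-- `radius_eq`: the line restates the tree's `FrozenTop.radius_eq`; taken BY NAME (gate lint dedup.landed).

-- `forall_of_forall_ne_zero`: the line restates the tree's `StretchedTop.forall_of_forall_ne_zero`; taken BY NAME (gate lint dedup.landed).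

-- `lapD_eq_zero_of_eq_zero`: the line restates the tree's `FrozenTop.lapD_eq_zero_of_eq_zero`; taken BY NAME (gate lint dedup.landed).

-- `jointCond_everywhere₆`: the line restates the tree's `FrozenTop.jointCond_everywhere₄`; taken BY NAME (gate lint dedup.landed).

end Summit.NavierStokesRegularity.NavierStokesRegularity.Theorems.ScenarioCensus.IntegratedQuench

end
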